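import Literature.NumberTheory.LFunctions.DirichletPolynomialMeanValue
import Literature.NumberTheory.LFunctions.AFEHarmonicSums
import Mathlib.MeasureTheory.Integral.DominatedConvergence
import HarnessLib

/-!
# A mean value theorem for Dirichlet polynomials, sharp in the length

For complex coefficients `a_n` (finitely supported on `[1, N]`, or an `ℓ¹` sequence with
`∑ n |a_n|² < ∞`) and a window of half-length `W`, we prove
`∫_{Y-W}^{Y+W} |∑ a_n n^{-it}|² dt ≤ ∑ (5W + 20 + 65 n) |a_n|²`.
This is a weak, fully explicit form of the Montgomery–Vaughan mean value theorem
`∫_0^T |∑ a_n n^{-it}|² dt = ∑ |a_n|² (T + O(n))` (Montgomery–Vaughan 1974, Corollary 3): the point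
is the factor `W + O(n)` (and not `W + O(N)`) in front of `|a_n|²`, which is what the tail
integrals in the proof of Halász's theorem require (Granville–Soundararajan 2003, proof of
Lemma 3.2, "by appealing to Corollary 3 of Montgomery and Vaughan"), since there the
coefficients `f(n) log n / n^{1+α}` are supported on all `x`-smooth integers.

The proof majorises the window by a Gaussian, expands the square, integrates the Gaussian
against `(n/m)^{-it}` exactly (reusing `Literature.DirichletMVT`-style helpers of
`DirichletPolynomialMeanValue`), and bounds the row sums of the resulting kernel
`exp(-W² (log n - log m)²/4)` by `1 + O(n/W)`: the near part `m ≤ 2n` via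
`|log n - log m| ≥ |n-m|/(2n)`, the far part `m > 2n` by a geometric series.

## Main results
- `Literature.NumberTheory.LFunctions.DirichletMVT.meanSquare_le_sharp` : `W ≥ 4`:
  `∫_{-W}^{W} |∑_{n ≤ N} a_n n^{-it}|² dt ≤ ∑_{n ≤ N} (5W + 65 n)|a_n|²`.
- `Literature.NumberTheory.LFunctions.DirichletMVT.meanSquare_shift_le` : any `W > 0`, any centre `Y`:
  `∫_{Y-W}^{Y+W} |∑_{n ≤ N} a_n n^{-it}|² dt ≤ ∑_{n ≤ N} (5W + 20 + 65 n)|a_n|²`.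
- `Literature.NumberTheory.LFunctions.DirichletMVT.meanSquare_tsum_shift_le` : the same for `ℓ¹` sequences `c` with
  `∑ n |c_n|² < ∞` (dominated convergence).

## References
- [MontgomeryVaughan1974] H. L. Montgomery, R. C. Vaughan, *Hilbert's inequality*, J. London Math.
  Soc. (2) 8 (1974), Corollary 3.
- [GranvilleSoundararajan2003] A. Granville, K. Soundararajan, *Decay of mean values of
  multiplicative functions*, Canad. J. Math. 55 (2003), proof of Lemma 3.2.
-/

noncomputable section

open Finset Real MeasureTheory Complex Filter Topology
open scoped ComplexConjugate

namespace Literature.NumberTheory.LFunctions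

namespace DirichletMVT

/-! ### Row sums of the Gaussian kernel in logarithmic scale, refined -/

/-- Near part of the row sum: for `1 ≤ n` and `m ∈ s ⊆ [1, 2n]`,
`∑_{m ∈ s} exp(-W² (log n - log m)²/4) ≤ 1 + 4√π n / W`, via `|log n - log m| ≥ |n - m|/(2n)`.
[folklore] -/
lemma sum_exp_log_kernel_near_le {W : ℝ} (hW : 0 < W) {n : ℕ} (hn : 1 ≤ n) (s : Finset ℕ)
    (hs : ∀ m ∈ s, 1 ≤ m ∧ m ≤ 2 * n) :
    ∑ m ∈ s, Real.exp (-(W ^ 2 * (Real.log n - Real.log m) ^ 2 / 4)) ≤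
      1 + 4 * Real.sqrt π * n / W := by
  have hn0 : (0 : ℝ) < n := by exact_mod_cast hn
  set N : ℕ := 2 * n with hNdef
  have hN0 : (0 : ℝ) < N := by simp only [hNdef]; push_cast; linarith
  set c : ℝ := W ^ 2 / (4 * (N : ℝ) ^ 2) with hc_def
  have hc : 0 < c := by positivity
  set g : ℤ → ℝ := fun j => Real.exp (-c * ((j : ℝ)) ^ 2) with hg_def
  have hg0 : ∀ j, 0 ≤ g j := fun j => (Real.exp_pos _).le
  -- Step 1: compare with the kernel in `n - m`.
  have step1 : ∀ m ∈ s,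
      Real.exp (-(W ^ 2 * (Real.log n - Real.log m) ^ 2 / 4)) ≤ g ((n : ℤ) - m) := by
    intro m hm
    obtain ⟨hm1, hm2⟩ := hs m hm
    have hm0 : (0 : ℝ) < m := by exact_mod_cast hm1
    have hmN : (m : ℝ) ≤ N := by simp only [hNdef]; exact_mod_cast hm2
    have hnN : (n : ℝ) ≤ N := by simp only [hNdef]; push_cast; linarith
    simp only [hg_def]
    apply Real.exp_le_exp.mpr
    have key : |((n : ℝ) - m)| / N ≤ |Real.log n - Real.log m| := by
      rcases le_total (m : ℝ) n with hmn | hmn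
      · rw [abs_of_nonneg (by linarith), abs_of_nonneg (by
          linarith [Real.log_le_log hm0 hmn])]
        have := Real.one_sub_inv_le_log_of_pos (div_pos hn0 hm0)
        rw [Real.log_div hn0.ne' hm0.ne', inv_div] at this
        calc ((n : ℝ) - m) / N ≤ ((n : ℝ) - m) / n := by gcongr
          _ = 1 - m / n := by field_simp
          _ ≤ _ := this
      · rw [abs_of_nonpos (by linarith), abs_of_nonpos (by
          linarith [Real.log_le_log hn0 hmn])]
        have := Real.one_sub_inv_le_log_of_pos (div_pos hm0 hn0)
        rw [Real.log_div hm0.ne' hn0.ne', inv_div] at this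
        calc -((n : ℝ) - m) / N = ((m : ℝ) - n) / N := by ring
          _ ≤ ((m : ℝ) - n) / m := by gcongr
          _ = 1 - n / m := by field_simp
          _ ≤ Real.log m - Real.log n := this
          _ = _ := by ring
    have key2 : (((n : ℝ) - m) / N) ^ 2 ≤ (Real.log n - Real.log m) ^ 2 := by
      rw [← sq_abs (((n : ℝ) - m) / N), ← sq_abs (Real.log n - Real.log m), abs_div,
        abs_of_pos hN0]
      exact pow_le_pow_left₀ (by positivity) key 2
    have : c * (((n : ℤ) - m : ℤ) : ℝ) ^ 2 = W ^ 2 * ((((n : ℝ) - m) / N) ^ 2) / 4 := by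
      push_cast
      simp only [hc_def]
      field_simp
    rw [neg_mul, this, neg_le_neg_iff]
    gcongr
  -- Step 2: reindex by `j = n - m ∈ [-N, N]`.
  have step2 : ∑ m ∈ s, g ((n : ℤ) - m) ≤ ∑ j ∈ Finset.Icc (-(N : ℤ)) N, g j := by
    rw [← Finset.sum_image (s := s) (g := fun m : ℕ => (n : ℤ) - m) (f := g)
      (fun x _ y _ hxy => by simpa using hxy)]
    refine Finset.sum_le_sum_of_subset_of_nonneg ?_ fun j _ _ => hg0 j
    intro j hj
    simp only [Finset.mem_image, Finset.mem_Icc] at hj ⊢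
    obtain ⟨m, hm, rfl⟩ := hj
    obtain ⟨hm1, hm2⟩ := hs m hm
    omega
  -- Step 3: the symmetric sum is at most `g 0 + 2 ∑_{k=1}^{N} g k`.
  have step3 : ∑ j ∈ Finset.Icc (-(N : ℤ)) N, g j ≤
      1 + 2 * ∑ k ∈ Finset.range N, Real.exp (-c * ((k : ℝ) + 1) ^ 2) := by
    set A : Finset ℤ := (Finset.range N).image fun k : ℕ => ((k : ℤ) + 1) with hA
    set B : Finset ℤ := (Finset.range N).image fun k : ℕ => -((k : ℤ) + 1) with hB
    have hsub : Finset.Icc (-(N : ℤ)) N ⊆ {0} ∪ (A ∪ B) := by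
      intro j hj
      simp only [Finset.mem_Icc] at hj
      simp only [hA, hB, Finset.mem_union, Finset.mem_singleton, Finset.mem_image,
        Finset.mem_range]
      rcases lt_trichotomy j 0 with h | h | h
      · right; right; exact ⟨(-j).toNat - 1, by omega, by omega⟩
      · left; exact h
      · right; left; exact ⟨j.toNat - 1, by omega, by omega⟩
    have hunion : ∀ s t : Finset ℤ, ∑ j ∈ s ∪ t, g j ≤ ∑ j ∈ s, g j + ∑ j ∈ t, g j := by
      intro s t
      rw [← Finset.sum_union_inter]
      linarith [Finset.sum_nonneg (s := s ∩ t) fun j _ => hg0 j]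
    have hA' : ∑ j ∈ A, g j ≤ ∑ k ∈ Finset.range N, Real.exp (-c * ((k : ℝ) + 1) ^ 2) := by
      rw [hA, Finset.sum_image (fun x _ y _ hxy => by simpa using hxy)]
      refine le_of_eq (Finset.sum_congr rfl fun k _ => ?_)
      simp [hg_def]
    have hB' : ∑ j ∈ B, g j ≤ ∑ k ∈ Finset.range N, Real.exp (-c * ((k : ℝ) + 1) ^ 2) := by
      rw [hB, Finset.sum_image (fun x _ y _ hxy => by simpa using hxy)]
      refine le_of_eq (Finset.sum_congr rfl fun k _ => ?_)
      simp only [hg_def]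
      push_cast
      ring_nf
    have hg00 : g 0 = 1 := by simp [hg_def]
    calc ∑ j ∈ Finset.Icc (-(N : ℤ)) N, g j ≤ ∑ j ∈ {0} ∪ (A ∪ B), g j :=
          Finset.sum_le_sum_of_subset_of_nonneg hsub fun j _ _ => hg0 j
      _ ≤ ∑ j ∈ ({0} : Finset ℤ), g j + (∑ j ∈ A, g j + ∑ j ∈ B, g j) :=
          (hunion _ _).trans (by gcongr; exact hunion _ _)
      _ ≤ 1 + 2 * ∑ k ∈ Finset.range N, Real.exp (-c * ((k : ℝ) + 1) ^ 2) := by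
          rw [Finset.sum_singleton, hg00]; linarith
  -- Step 4: Gaussian tail.
  have step4 := sum_exp_neg_mul_sq_le c hc N
  have hsqrt : Real.sqrt (π / c) / 2 = Real.sqrt π * N / W := by
    have : π / c = π * (2 * N / W) ^ 2 := by simp only [hc_def]; field_simp; norm_num
    rw [this, Real.sqrt_mul pi_pos.le, Real.sqrt_sq (by positivity)]
    field_simp
  have hNn : (N : ℝ) = 2 * n := by simp only [hNdef]; push_cast; ring
  calc ∑ m ∈ s, Real.exp (-(W ^ 2 * (Real.log n - Real.log m) ^ 2 / 4))
      ≤ ∑ m ∈ s, g ((n : ℤ) - m) := Finset.sum_le_sum step1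
    _ ≤ _ := step2
    _ ≤ _ := step3
    _ ≤ 1 + 2 * (Real.sqrt (π / c) / 2) := by linarith
    _ = 1 + 2 * Real.sqrt π * N / W := by rw [hsqrt]; ring
    _ = 1 + 4 * Real.sqrt π * n / W := by rw [hNn]; ring

/-- Far part of the row sum: for `W ≥ 4`, `1 ≤ n` and `m ∈ s` with `m > 2n`,
`∑_{m ∈ s} exp(-W² (log n - log m)²/4) ≤ 5 n / W`: the terms are at most
`(n/m)² · 4 exp(-W² (log 2)²/4)` and `∑_{m > 2n} (n/m)² ≤ n/2`. [folklore] -/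
lemma sum_exp_log_kernel_far_le {W : ℝ} (hW : 4 ≤ W) {n : ℕ} (hn : 1 ≤ n) (s : Finset ℕ)
    (hs : ∀ m ∈ s, 2 * n < m) :
    ∑ m ∈ s, Real.exp (-(W ^ 2 * (Real.log n - Real.log m) ^ 2 / 4)) ≤ 5 * n / W := by
  have hn0 : (0 : ℝ) < n := by exact_mod_cast hn
  have hW0 : 0 < W := by linarith
  have hlog2 : (0.69 : ℝ) < Real.log 2 := by
    have := Real.log_two_gt_d9; linarith
  have hlog2' : Real.log 2 < 0.7 := by
    have := Real.log_two_lt_d9; linarith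
  set κ' : ℝ := W ^ 2 * Real.log 2 ^ 2 / 4 with hκ'
  -- termwise bound
  have hterm : ∀ m ∈ s, Real.exp (-(W ^ 2 * (Real.log n - Real.log m) ^ 2 / 4)) ≤
      ((n : ℝ) / m) ^ 2 * (4 * Real.exp (-κ')) := by
    intro m hm
    have hm := hs m hm
    have hm0 : (0 : ℝ) < m := by exact_mod_cast (show 0 < m by omega)
    have hmn : (2 : ℝ) * n < m := by exact_mod_cast hm
    set L : ℝ := Real.log m - Real.log n with hL
    have hL2 : Real.log 2 ≤ L := by
      have : Real.log 2 + Real.log n ≤ Real.log m := by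
        rw [← Real.log_mul (by norm_num) hn0.ne']
        exact Real.log_le_log (by positivity) hmn.le
      simp only [hL]; linarith
    have hsq : (Real.log n - Real.log m) ^ 2 = L ^ 2 := by simp only [hL]; ring
    rw [hsq]
    -- `(n/m)² = exp(-2L)`
    have hnm : ((n : ℝ) / m) ^ 2 = Real.exp (-(2 * L)) := by
      have hl : Real.log ((n : ℝ) / m) = -L := by
        rw [Real.log_div hn0.ne' hm0.ne']; simp only [hL]; ring
      rw [show -(2 * L) = Real.log ((n : ℝ) / m) + Real.log ((n : ℝ) / m) by rw [hl]; ring,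
        Real.exp_add, Real.exp_log (by positivity), sq]
    have h4 : (4 : ℝ) = Real.exp (2 * Real.log 2) := by
      rw [two_mul, Real.exp_add, Real.exp_log (by norm_num)]; norm_num
    -- `W² L²/4 ≥ 2L - 2 log 2 + κ'`, i.e. `(L - log 2) ((W²/4)(L + log 2) - 2) ≥ 0`
    have hW2 : (16 : ℝ) ≤ W ^ 2 := by nlinarith
    have h1 : 0 ≤ L - Real.log 2 := by linarith
    have h2 : 0 ≤ W ^ 2 / 4 * (L + Real.log 2) - 2 := by nlinarith
    have hprod := mul_nonneg h1 h2
    have hexpand : (L - Real.log 2) * (W ^ 2 / 4 * (L + Real.log 2) - 2) =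
        W ^ 2 * L ^ 2 / 4 - 2 * L + 2 * Real.log 2 - W ^ 2 * Real.log 2 ^ 2 / 4 := by ring
    have key : -(W ^ 2 * L ^ 2 / 4) ≤ -(2 * L) + (2 * Real.log 2 + -κ') := by
      simp only [hκ']; linarith
    calc Real.exp (-(W ^ 2 * L ^ 2 / 4)) ≤ Real.exp (-(2 * L) + (2 * Real.log 2 + -κ')) :=
          Real.exp_le_exp.mpr key
      _ = ((n : ℝ) / m) ^ 2 * (4 * Real.exp (-κ')) := by
          rw [Real.exp_add, Real.exp_add, hnm, h4]
  -- sum of `(n/m)²`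
  have hsum : ∑ m ∈ s, ((n : ℝ) / m) ^ 2 ≤ n / 2 := by
    have hsub : s ⊆ Finset.Ioc (2 * n) (s.sup id) := by
      intro m hm
      rw [Finset.mem_Ioc]
      exact ⟨hs m hm, Finset.le_sup (f := id) hm⟩
    calc ∑ m ∈ s, ((n : ℝ) / m) ^ 2 ≤ ∑ m ∈ Finset.Ioc (2 * n) (s.sup id), ((n : ℝ) / m) ^ 2 :=
          Finset.sum_le_sum_of_subset_of_nonneg hsub fun m _ _ => by positivity
      _ = (n : ℝ) ^ 2 * ∑ m ∈ Finset.Ioc (2 * n) (s.sup id), 1 / (m : ℝ) ^ 2 := by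
          rw [Finset.mul_sum]
          refine Finset.sum_congr rfl fun m _ => ?_
          ring
      _ ≤ (n : ℝ) ^ 2 * (1 / ((2 * n : ℕ) : ℝ)) := by
          gcongr
          exact Literature.NumberTheory.LFunctions.AFE.sum_Ioc_inv_sq_le (by omega) _
      _ = n / 2 := by push_cast; field_simp
  -- `4 exp(-κ') ≤ 10 / W`
  have hexp : 4 * Real.exp (-κ') * (n / 2) ≤ 5 * n / W := by
    -- `W exp(-κ') ≤ 5/2`: from `exp κ' ≥ 1 + κ' ≥ κ' ≥ 0.119 W² ≥ 0.476 W`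
    have hκW : 0.4 * W ≤ κ' := by
      simp only [hκ']
      have hl2 : (0.4 : ℝ) ≤ Real.log 2 ^ 2 := by nlinarith
      have hW2 : 0 ≤ W ^ 2 := sq_nonneg W
      have : (0.1 : ℝ) * W ^ 2 ≤ W ^ 2 * Real.log 2 ^ 2 / 4 := by
        have := mul_le_mul_of_nonneg_left hl2 hW2
        linarith
      nlinarith
    have hexpk : κ' ≤ Real.exp κ' := by linarith [Real.add_one_le_exp κ']
    have hek : 0 < Real.exp κ' := Real.exp_pos _
    rw [Real.exp_neg]
    rw [show 4 * (Real.exp κ')⁻¹ * ((n : ℝ) / 2) = 2 * n / Real.exp κ' by field_simp; ring]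
    rw [div_le_div_iff₀ hek hW0]
    nlinarith
  calc ∑ m ∈ s, Real.exp (-(W ^ 2 * (Real.log n - Real.log m) ^ 2 / 4))
      ≤ ∑ m ∈ s, ((n : ℝ) / m) ^ 2 * (4 * Real.exp (-κ')) := Finset.sum_le_sum hterm
    _ = 4 * Real.exp (-κ') * ∑ m ∈ s, ((n : ℝ) / m) ^ 2 := by rw [Finset.mul_sum]; refine Finset.sum_congr rfl fun m _ => by ring
    _ ≤ 4 * Real.exp (-κ') * (n / 2) := by gcongr
    _ ≤ 5 * n / W := hexp

/-- Refined row sum of the Gaussian kernel in `log`: for `W ≥ 4` and `1 ≤ n`,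
`∑_{m=1}^{N} exp(-W² (log n - log m)²/4) ≤ 1 + 13 n / W` (uniformly in `N`). [folklore] -/
lemma sum_exp_log_kernel_le_sharp {W : ℝ} (hW : 4 ≤ W) {n : ℕ} (hn : 1 ≤ n) (N : ℕ) :
    ∑ m ∈ Finset.Icc 1 N, Real.exp (-(W ^ 2 * (Real.log n - Real.log m) ^ 2 / 4)) ≤
      1 + 13 * n / W := by
  have hW0 : 0 < W := by linarith
  have hn0 : (0 : ℝ) ≤ n := by positivity
  rw [← Finset.sum_filter_add_sum_filter_not (Finset.Icc 1 N) (fun m => m ≤ 2 * n)]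
  have h1 := sum_exp_log_kernel_near_le hW0 hn ((Finset.Icc 1 N).filter fun m => m ≤ 2 * n)
    (fun m hm => by
      simp only [Finset.mem_filter, Finset.mem_Icc] at hm
      exact ⟨hm.1.1, hm.2⟩)
  have h2 := sum_exp_log_kernel_far_le hW hn ((Finset.Icc 1 N).filter fun m => ¬ m ≤ 2 * n)
    (fun m hm => by
      simp only [Finset.mem_filter, Finset.mem_Icc] at hm
      omega)
  have hsqrtpi : Real.sqrt π < 1.78 := by
    rw [Real.sqrt_lt' (by norm_num)]
    have := Real.pi_lt_d4; linarith
  have : 4 * Real.sqrt π * n / W + 5 * n / W ≤ 13 * n / W := by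
    rw [← add_div, div_le_div_iff_of_pos_right hW0]
    nlinarith
  linarith

/-! ### The mean value theorem -/

/-- **Mean value theorem for Dirichlet polynomials, sharp in the length** (cf.
Montgomery–Vaughan 1974, Cor. 3; Iwaniec–Kowalski Thm 9.1): for `W ≥ 4`,
`∫_{-W}^{W} |∑_{n=1}^{N} a_n n^{-it}|² dt ≤ ∑_{n=1}^{N} (5W + 65 n) |a_n|²`.
Proof by Gaussian smoothing as in `Literature.NumberTheory.LFunctions.dirichletPolynomial_meanSquare_le`, with the refined row-sum
bound `sum_exp_log_kernel_le_sharp`. [folklore] -/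
theorem meanSquare_le_sharp (a : ℕ → ℂ) (N : ℕ) {W : ℝ} (hW : 4 ≤ W) :
    ∫ t in -W..W, ‖∑ n ∈ Finset.Icc 1 N, a n * (n : ℂ) ^ (-((t : ℂ) * I))‖ ^ 2 ≤
      ∑ n ∈ Finset.Icc 1 N, (5 * W + 65 * n) * ‖a n‖ ^ 2 := by
  have hT : 0 < W := by linarith
  -- the phases as exponentials
  set e : ℕ → ℝ → ℂ := fun n t => Complex.exp ((-(t * Real.log n) : ℝ) * I) with he
  set D : ℝ → ℂ := fun t => ∑ n ∈ Finset.Icc 1 N, a n * e n t with hD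
  have hDe : ∀ t : ℝ, ∑ n ∈ Finset.Icc 1 N, a n * (n : ℂ) ^ (-((t : ℂ) * I)) = D t := by
    intro t
    refine Finset.sum_congr rfl fun n hn => ?_
    rw [Finset.mem_Icc] at hn
    rw [natCast_cpow_neg_mul_I (by omega)]
  simp_rw [hDe]
  have he1 : ∀ n t, ‖e n t‖ = 1 := fun n t => Complex.norm_exp_ofReal_mul_I _
  have hDcont : Continuous D := by
    refine continuous_finsetSum _ fun n _ => continuous_const.mul ?_
    simp only [he]
    fun_prop
  set A : ℝ := ∑ n ∈ Finset.Icc 1 N, ‖a n‖ with hA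
  have hDbd : ∀ t, ‖D t‖ ≤ A := by
    intro t
    refine (norm_sum_le _ _).trans (le_of_eq (Finset.sum_congr rfl fun n _ => ?_))
    rw [norm_mul, he1, mul_one]
  set b : ℝ := (W ^ 2)⁻¹ with hb
  have hb0 : 0 < b := by positivity
  set γ : ℝ → ℝ := fun t => Real.exp (-b * t ^ 2) with hγ
  have hγint : Integrable γ := integrable_exp_neg_mul_sq hb0
  have hγcont : Continuous γ := by simp only [hγ]; fun_prop
  have step1 : ∫ t in -W..W, ‖D t‖ ^ 2 ≤ ∫ t in -W..W, Real.exp 1 * γ t * ‖D t‖ ^ 2 := by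
    refine intervalIntegral.integral_mono_on (by linarith) ?_ ?_ fun t ht => ?_
    · exact ((continuous_norm.comp hDcont).pow 2).intervalIntegrable _ _
    · exact ((continuous_const.mul hγcont).mul ((continuous_norm.comp hDcont).pow 2)).intervalIntegrable _ _
    · have h1 : 1 ≤ Real.exp 1 * γ t := by
        simp only [hγ, ← Real.exp_add]
        apply Real.one_le_exp
        have : t ^ 2 ≤ W ^ 2 := by
          rw [← sq_abs t, ← sq_abs W, abs_of_pos hT]
          exact pow_le_pow_left₀ (abs_nonneg t) (abs_le.mpr ⟨ht.1, ht.2⟩) 2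
        have : b * t ^ 2 ≤ 1 := by
          simp only [hb]
          rw [inv_mul_le_iff₀ (by positivity)]
          simpa using this
        linarith
      nlinarith [sq_nonneg ‖D t‖]
  have hFint : Integrable fun t => Real.exp 1 * γ t * ‖D t‖ ^ 2 := by
    have : Integrable fun t => (Real.exp 1 * ‖D t‖ ^ 2) * γ t := by
      refine hγint.bdd_mul (c := Real.exp 1 * A ^ 2) ?_ ?_
      · exact (continuous_const.mul ((continuous_norm.comp hDcont).pow 2)).aestronglyMeasurable
      · refine Filter.Eventually.of_forall fun t => ?_
        rw [Real.norm_of_nonneg (by positivity)]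
        gcongr
        exact hDbd t
    exact this.congr (Filter.Eventually.of_forall fun t => by ring)
  have step2 : ∫ t in -W..W, Real.exp 1 * γ t * ‖D t‖ ^ 2 ≤
      ∫ t, Real.exp 1 * γ t * ‖D t‖ ^ 2 := by
    rw [intervalIntegral.integral_of_le (by linarith)]
    exact setIntegral_le_integral hFint (Filter.Eventually.of_forall fun t => by positivity)
  set E : ℕ → ℕ → ℝ := fun m n => Real.exp (-(W ^ 2 * (Real.log n - Real.log m) ^ 2 / 4)) with hE
  have integrable_term : ∀ L : ℝ, ∀ c : ℂ,
      Integrable fun x : ℝ => c * (Complex.exp ((L : ℂ) * x * I) * (γ x : ℂ)) := by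
    intro L c
    refine Integrable.const_mul ?_ _
    refine hγint.ofReal.bdd_mul (c := 1) ?_ ?_
    · exact (Continuous.cexp (by fun_prop)).aestronglyMeasurable
    · refine Filter.Eventually.of_forall fun x => le_of_eq ?_
      rw [show (L : ℂ) * x * I = ((L * x : ℝ) : ℂ) * I by push_cast; ring]
      exact Complex.norm_exp_ofReal_mul_I _
  have step3 : ((∫ t, γ t * ‖D t‖ ^ 2 : ℝ) : ℂ) =
      ∑ m ∈ Finset.Icc 1 N, ∑ n ∈ Finset.Icc 1 N,
        a m * conj (a n) * ((W * Real.sqrt π * E m n : ℝ) : ℂ) := by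
    rw [← integral_complex_ofReal]
    have hpt : ∀ t : ℝ, ((γ t * ‖D t‖ ^ 2 : ℝ) : ℂ) =
        ∑ m ∈ Finset.Icc 1 N, ∑ n ∈ Finset.Icc 1 N,
          a m * conj (a n) * (Complex.exp (((Real.log n - Real.log m : ℝ) : ℂ) * t * I) * (γ t : ℂ)) := by
      intro t
      rw [Complex.ofReal_mul, ofReal_norm_sq_sum_eq, Finset.mul_sum]
      refine Finset.sum_congr rfl fun m _ => ?_
      rw [Finset.mul_sum]
      refine Finset.sum_congr rfl fun n _ => ?_
      simp only [he, map_mul, conj_exp_ofReal_mul_I]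
      have : Complex.exp (((-(t * Real.log m)) : ℝ) * I) * Complex.exp (((-(-(t * Real.log n))) : ℝ) * I)
          = Complex.exp (((Real.log n - Real.log m : ℝ) : ℂ) * t * I) := by
        rw [← Complex.exp_add]
        congr 1
        push_cast
        ring
      calc (γ t : ℂ) * (a m * Complex.exp (((-(t * Real.log m)) : ℝ) * I) *
            (conj (a n) * Complex.exp (((-(-(t * Real.log n))) : ℝ) * I)))
          = a m * conj (a n) * ((Complex.exp (((-(t * Real.log m)) : ℝ) * I) *
              Complex.exp (((-(-(t * Real.log n))) : ℝ) * I)) * (γ t : ℂ)) := by ring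
        _ = _ := by rw [this]
    simp_rw [hpt]
    rw [integral_finsetSum]
    · refine Finset.sum_congr rfl fun m _ => ?_
      rw [integral_finsetSum]
      · refine Finset.sum_congr rfl fun n _ => ?_
        rw [integral_const_mul]
        congr 1
        have := integral_exp_mul_I_mul_gaussian hT (Real.log n - Real.log m)
        simp only [hγ, hb, hE]
        convert this using 3
      · intro n _
        exact integrable_term _ _
    · intro m _
      exact integrable_finsetSum _ fun n _ => integrable_term _ _
  have hE0 : ∀ m n, 0 ≤ E m n := fun m n => (Real.exp_pos _).le
  have hEsymm : ∀ m n, E m n = E n m := by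
    intro m n; simp only [hE]; congr 3; ring
  have step4 : ∫ t, γ t * ‖D t‖ ^ 2 ≤
      W * Real.sqrt π * ∑ m ∈ Finset.Icc 1 N, ∑ n ∈ Finset.Icc 1 N, ‖a m‖ * ‖a n‖ * E m n := by
    have hre : (∫ t, γ t * ‖D t‖ ^ 2) = (((∫ t, γ t * ‖D t‖ ^ 2 : ℝ) : ℂ)).re := by simp
    rw [hre, step3]
    refine (Complex.re_le_norm _).trans ?_
    refine (norm_sum_le _ _).trans ?_
    rw [Finset.mul_sum]
    refine Finset.sum_le_sum fun m _ => ?_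
    refine (norm_sum_le _ _).trans ?_
    rw [Finset.mul_sum]
    refine Finset.sum_le_sum fun n _ => le_of_eq ?_
    rw [norm_mul, norm_mul, Complex.norm_conj, Complex.norm_real, Real.norm_of_nonneg
      (by positivity : (0 : ℝ) ≤ W * Real.sqrt π * E m n)]
    ring
  -- Step 5: Young's inequality, symmetry, and the refined kernel row-sum bound
  have step5 : ∑ m ∈ Finset.Icc 1 N, ∑ n ∈ Finset.Icc 1 N, ‖a m‖ * ‖a n‖ * E m n ≤
      ∑ n ∈ Finset.Icc 1 N, ‖a n‖ ^ 2 * (1 + 13 * n / W) := by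
    refine (sum_sum_mul_mul_le_of_symm _ (fun n => ‖a n‖) E hEsymm hE0).trans ?_
    refine Finset.sum_le_sum fun n hn => ?_
    rw [Finset.mem_Icc] at hn
    gcongr
    exact sum_exp_log_kernel_le_sharp hW hn.1 N
  -- Step 6: numerics `e √π < 5`
  have he3 : Real.exp 1 < 2.7182818286 := Real.exp_one_lt_d9
  have hpi : π < 3.1416 := Real.pi_lt_d4
  have hsqrtpi : Real.sqrt π < 1.78 := by
    rw [Real.sqrt_lt' (by norm_num)]
    linarith
  have hsqrtpi0 : 0 ≤ Real.sqrt π := Real.sqrt_nonneg _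
  have he0 : 0 < Real.exp 1 := Real.exp_pos 1
  have hes : Real.exp 1 * Real.sqrt π ≤ 5 := by nlinarith
  calc ∫ t in -W..W, ‖D t‖ ^ 2
      ≤ ∫ t in -W..W, Real.exp 1 * γ t * ‖D t‖ ^ 2 := step1
    _ ≤ ∫ t, Real.exp 1 * γ t * ‖D t‖ ^ 2 := step2
    _ = Real.exp 1 * ∫ t, γ t * ‖D t‖ ^ 2 := by
        rw [← integral_const_mul]
        refine integral_congr_ae (Filter.Eventually.of_forall fun t => ?_)
        simp only; ring
    _ ≤ Real.exp 1 * (W * Real.sqrt π * ∑ n ∈ Finset.Icc 1 N, ‖a n‖ ^ 2 * (1 + 13 * n / W)) := by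
        gcongr
        exact step4.trans (by gcongr)
    _ = ∑ n ∈ Finset.Icc 1 N, (Real.exp 1 * Real.sqrt π) * ((W + 13 * n) * ‖a n‖ ^ 2) := by
        rw [Finset.mul_sum, Finset.mul_sum]
        refine Finset.sum_congr rfl fun n _ => ?_
        field_simp
    _ ≤ ∑ n ∈ Finset.Icc 1 N, 5 * ((W + 13 * n) * ‖a n‖ ^ 2) := by
        refine Finset.sum_le_sum fun n _ => ?_
        have : 0 ≤ (W + 13 * n) * ‖a n‖ ^ 2 := by positivity
        exact mul_le_mul_of_nonneg_right hes this
    _ = ∑ n ∈ Finset.Icc 1 N, (5 * W + 65 * n) * ‖a n‖ ^ 2 := by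
        refine Finset.sum_congr rfl fun n _ => by ring

/-- Shifted window: for `W ≥ 4` and any centre `Y`,
`∫_{Y-W}^{Y+W} |∑_{n=1}^{N} a_n n^{-it}|² dt ≤ ∑_{n=1}^{N} (5W + 65 n) |a_n|²`. [folklore] -/
theorem meanSquare_shift_le_sharp (a : ℕ → ℂ) (N : ℕ) {W : ℝ} (hW : 4 ≤ W) (Y : ℝ) :
    ∫ t in (Y - W)..(Y + W), ‖∑ n ∈ Finset.Icc 1 N, a n * (n : ℂ) ^ (-((t : ℂ) * I))‖ ^ 2 ≤
      ∑ n ∈ Finset.Icc 1 N, (5 * W + 65 * n) * ‖a n‖ ^ 2 := by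
  -- substitute `t = u + Y`
  have hsub : ∫ t in (Y - W)..(Y + W), ‖∑ n ∈ Finset.Icc 1 N, a n * (n : ℂ) ^ (-((t : ℂ) * I))‖ ^ 2
      = ∫ u in -W..W, ‖∑ n ∈ Finset.Icc 1 N, a n * (n : ℂ) ^ (-(((u + Y : ℝ) : ℂ) * I))‖ ^ 2 := by
    rw [intervalIntegral.integral_comp_add_right (fun t : ℝ =>
      ‖∑ n ∈ Finset.Icc 1 N, a n * (n : ℂ) ^ (-((t : ℂ) * I))‖ ^ 2) Y,
      show -W + Y = Y - W by ring, show W + Y = Y + W by ring]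
  rw [hsub]
  set a' : ℕ → ℂ := fun n => a n * (n : ℂ) ^ (-((Y : ℂ) * I)) with ha'
  have hpt : ∀ u : ℝ, ∑ n ∈ Finset.Icc 1 N, a n * (n : ℂ) ^ (-(((u + Y : ℝ) : ℂ) * I)) =
      ∑ n ∈ Finset.Icc 1 N, a' n * (n : ℂ) ^ (-((u : ℂ) * I)) := by
    intro u
    refine Finset.sum_congr rfl fun n hn => ?_
    rw [Finset.mem_Icc] at hn
    have hn0 : (n : ℂ) ≠ 0 := by exact_mod_cast (show n ≠ 0 by omega)
    simp only [ha']
    rw [mul_assoc, ← Complex.cpow_add _ _ hn0]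
    congr 2
    push_cast
    ring
  simp_rw [hpt]
  have hnorm : ∀ n ∈ Finset.Icc 1 N, ‖a' n‖ = ‖a n‖ := by
    intro n hn
    rw [Finset.mem_Icc] at hn
    simp only [ha', norm_mul]
    rw [natCast_cpow_neg_mul_I (by omega), Complex.norm_exp_ofReal_mul_I, mul_one]
  calc _ ≤ ∑ n ∈ Finset.Icc 1 N, (5 * W + 65 * n) * ‖a' n‖ ^ 2 := meanSquare_le_sharp a' N hW
    _ = _ := Finset.sum_congr rfl fun n hn => by rw [hnorm n hn]

/-- Any window: for `W > 0` and any centre `Y`,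
`∫_{Y-W}^{Y+W} |∑_{n=1}^{N} a_n n^{-it}|² dt ≤ ∑_{n=1}^{N} (5W + 20 + 65 n) |a_n|²`
(pad the window to half-length `max W 4`). [folklore] -/
theorem meanSquare_shift_le (a : ℕ → ℂ) (N : ℕ) {W : ℝ} (hW : 0 < W) (Y : ℝ) :
    ∫ t in (Y - W)..(Y + W), ‖∑ n ∈ Finset.Icc 1 N, a n * (n : ℂ) ^ (-((t : ℂ) * I))‖ ^ 2 ≤
      ∑ n ∈ Finset.Icc 1 N, (5 * W + 20 + 65 * n) * ‖a n‖ ^ 2 := by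
  set W' := max W 4 with hW'
  have hW'4 : 4 ≤ W' := le_max_right _ _
  have hWW' : W ≤ W' := le_max_left _ _
  have hcont : Continuous fun t : ℝ => ‖∑ n ∈ Finset.Icc 1 N, a n * (n : ℂ) ^ (-((t : ℂ) * I))‖ ^ 2 := by
    refine (continuous_norm.comp (continuous_finsetSum _ fun n hn => continuous_const.mul ?_)).pow 2
    rw [Finset.mem_Icc] at hn
    have : (fun t : ℝ => (n : ℂ) ^ (-((t : ℂ) * I))) = fun t : ℝ => Complex.exp ((-(t * Real.log n) : ℝ) * I) := by
      funext t; exact natCast_cpow_neg_mul_I (by omega) t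
    rw [this]; fun_prop
  calc ∫ t in (Y - W)..(Y + W), ‖∑ n ∈ Finset.Icc 1 N, a n * (n : ℂ) ^ (-((t : ℂ) * I))‖ ^ 2
      ≤ ∫ t in (Y - W')..(Y + W'), ‖∑ n ∈ Finset.Icc 1 N, a n * (n : ℂ) ^ (-((t : ℂ) * I))‖ ^ 2 := by
        refine intervalIntegral.integral_mono_interval (by linarith) (by linarith) (by linarith)
          (Filter.Eventually.of_forall fun t => by positivity) (hcont.intervalIntegrable _ _)
    _ ≤ ∑ n ∈ Finset.Icc 1 N, (5 * W' + 65 * n) * ‖a n‖ ^ 2 := meanSquare_shift_le_sharp a N hW'4 Y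
    _ ≤ ∑ n ∈ Finset.Icc 1 N, (5 * W + 20 + 65 * n) * ‖a n‖ ^ 2 := by
        gcongr with n hn
        have : W' ≤ W + 4 := max_le (by linarith) (by linarith)
        linarith


/-! ### The `ℓ¹` version -/

/-- `∑_{n < N+1} f n = ∑_{1 ≤ n ≤ N} f n` when `f 0 = 0`. [folklore] -/
lemma sum_range_succ_eq_sum_Icc {M : Type*} [AddCommMonoid M] (f : ℕ → M) (hf : f 0 = 0) (N : ℕ) :
    ∑ n ∈ Finset.range (N + 1), f n = ∑ n ∈ Finset.Icc 1 N, f n := by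
  have : Finset.Icc 1 N = (Finset.range (N + 1)).filter (fun n => n ≠ 0) := by
    ext n; simp only [Finset.mem_Icc, Finset.mem_filter, Finset.mem_range]; omega
  rw [this, Finset.sum_filter_of_ne]
  intro n _ hn h0
  exact hn (by rw [h0, hf])

/-- **Mean value theorem, `ℓ¹` coefficients**: for `c : ℕ → ℂ` with `c 0 = 0`, `∑ |c_n| < ∞` and
`∑ n |c_n|² < ∞`, any `W > 0` and centre `Y`,
`∫_{Y-W}^{Y+W} |∑_n c_n n^{-it}|² dt ≤ ∑_n (5W + 20 + 65 n) |c_n|²`. [folklore] -/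
theorem meanSquare_tsum_shift_le {c : ℕ → ℂ} (hc : Summable fun n => ‖c n‖)
    (hc2 : Summable fun n : ℕ => (n : ℝ) * ‖c n‖ ^ 2) (h0 : c 0 = 0) {W : ℝ} (hW : 0 < W) (Y : ℝ) :
    ∫ t in (Y - W)..(Y + W), ‖∑' n, c n * (n : ℂ) ^ (-((t : ℂ) * I))‖ ^ 2 ≤
      ∑' n : ℕ, (5 * W + 20 + 65 * (n : ℝ)) * ‖c n‖ ^ 2 := by
  set u : ℕ → ℝ → ℂ := fun n t => c n * (n : ℂ) ^ (-((t : ℂ) * I)) with hu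
  -- termwise norm bound
  have hun : ∀ n t, ‖u n t‖ ≤ ‖c n‖ := by
    intro n t
    rcases Nat.eq_zero_or_pos n with rfl | hn
    · simp [hu, h0]
    · simp only [hu, norm_mul]
      rw [natCast_cpow_neg_mul_I hn.ne', Complex.norm_exp_ofReal_mul_I, mul_one]
  have hu0 : ∀ t, u 0 t = 0 := fun t => by simp [hu, h0]
  have hsum : ∀ t, Summable fun n => u n t := fun t =>
    Summable.of_norm_bounded hc (hun · t)
  set A : ℝ := ∑' n, ‖c n‖ with hA
  -- partial sums converge
  have hlim : ∀ t, Tendsto (fun N : ℕ => ∑ n ∈ Finset.Icc 1 N, u n t) atTop (𝓝 (∑' n, u n t)) := by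
    intro t
    have h1 := (hsum t).hasSum.tendsto_sum_nat
    have h2 := h1.comp (tendsto_add_atTop_nat 1)
    refine h2.congr fun N => ?_
    simp only [Function.comp]
    exact sum_range_succ_eq_sum_Icc (fun n => u n t) (hu0 t) N
  -- uniform bound on partial sums
  have hbdN : ∀ N t, ‖∑ n ∈ Finset.Icc 1 N, u n t‖ ≤ A := by
    intro N t
    refine (norm_sum_le _ _).trans ?_
    refine (Finset.sum_le_sum fun n _ => hun n t).trans ?_
    exact hc.sum_le_tsum _ (fun n _ => norm_nonneg _)
  -- the finite bound, uniformly in `N`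
  have hsqsum : Summable fun n => ‖c n‖ ^ 2 := by
    refine Summable.of_nonneg_of_le (fun n => sq_nonneg _) (fun n => ?_) hc2
    rcases Nat.eq_zero_or_pos n with rfl | hn
    · simp [h0]
    · have : (1 : ℝ) ≤ n := by exact_mod_cast hn
      nlinarith [sq_nonneg ‖c n‖]
  have hRsum : Summable fun n => (5 * W + 20 + 65 * n) * ‖c n‖ ^ 2 := by
    have : (fun n : ℕ => (5 * W + 20 + 65 * n) * ‖c n‖ ^ 2) =
        fun n : ℕ => (5 * W + 20) * ‖c n‖ ^ 2 + 65 * ((n : ℝ) * ‖c n‖ ^ 2) := by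
      funext n; ring
    rw [this]
    exact (hsqsum.mul_left _).add (hc2.mul_left _)
  have hfin : ∀ N, ∫ t in (Y - W)..(Y + W), ‖∑ n ∈ Finset.Icc 1 N, u n t‖ ^ 2 ≤
      ∑' n : ℕ, (5 * W + 20 + 65 * (n : ℝ)) * ‖c n‖ ^ 2 := by
    intro N
    refine (meanSquare_shift_le c N hW Y).trans ?_
    exact hRsum.sum_le_tsum _ (fun n _ => by positivity)
  -- dominated convergence on the window
  have hYW : Y - W ≤ Y + W := by linarith
  have hcontN : ∀ N, Continuous fun t : ℝ => ‖∑ n ∈ Finset.Icc 1 N, u n t‖ ^ 2 := by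
    intro N
    refine (continuous_norm.comp (continuous_finsetSum _ fun n hn => continuous_const.mul ?_)).pow 2
    rw [Finset.mem_Icc] at hn
    have : (fun t : ℝ => (n : ℂ) ^ (-((t : ℂ) * I))) = fun t : ℝ => Complex.exp ((-(t * Real.log n) : ℝ) * I) := by
      funext t; exact natCast_cpow_neg_mul_I (by omega) t
    rw [this]; fun_prop
  have htend : Tendsto (fun N : ℕ => ∫ t in (Y - W)..(Y + W), ‖∑ n ∈ Finset.Icc 1 N, u n t‖ ^ 2)
      atTop (𝓝 (∫ t in (Y - W)..(Y + W), ‖∑' n, u n t‖ ^ 2)) := by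
    simp_rw [intervalIntegral.integral_of_le hYW]
    refine tendsto_integral_of_dominated_convergence (fun _ => A ^ 2) (fun N => ?_) ?_ (fun N => ?_) ?_
    · exact (hcontN N).aestronglyMeasurable
    · exact integrableOn_const (by simp)
    · refine Filter.Eventually.of_forall fun t => ?_
      rw [Real.norm_of_nonneg (by positivity)]
      exact pow_le_pow_left₀ (norm_nonneg _) (hbdN N t) 2
    · refine Filter.Eventually.of_forall fun t => ?_
      exact ((continuous_norm.tendsto _).comp (hlim t)).pow 2
  exact le_of_tendsto' htend hfin

end DirichletMVT

end Literature.NumberTheory.LFunctions
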